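import Literature.NumberTheory.EllipticCurves.ZpExtensionCoeffTwistCores
import Literature.NumberTheory.EllipticCurves.ZpExtensionEisensteinTwistCoeffActionProofs
import HarnessLib

/-!
# The coefficient action of a general ring `A` on `H¹(K, M ⊗ A(χ_u))` through the tree's scalar-action layer,
# and, for `A = Λ/I`, the generators: `[T] ↦ u• − id`, `[C c] ↦ (c mod p^k)•` on `E[p^k] ⊗ (Λ/I)`,
# `X^N`-divisible series `↦ 0` when `X^N ∈ I` (proofs file: theorems only)

Topic `NumberTheory/EllipticCurves` (sequel of `ZpExtensionCoeffTwistCores`; generic-coefficient twin of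
`ZpExtensionEisensteinTwistCoeffActionProofs`, D1 lineage of the cell `pub/bsd-print-x9`). The `A`-module structure of
`H¹(K, M ⊗ A(χ_u))` is carried by the Galois endomorphisms `κ.coeffTwistSMulHom ρ hu c` under `galoisCohomology.map`;
§1 identifies it with `galoisCohomology.scalarMapH1` (so that additivity / multiplicativity / unit / integers come from
`GaloisCohomologyScalarAction`), §2 computes, for `A = Λ/I` and `u = [1 + T]`, the action of the generators of `Λ`
(the coefficient side of `LambdaAdicSelmerData.proj_X` / `proj_C` / `proj_cont`), which is what the `Λ`-linearity of the
level maps `𝔖_p(K_∞) → H¹(K, E[p^k] ⊗ (Λ/I)(ψ⁻¹))` (sequel, twin of `LambdaAdicSelmerDataToEisensteinH1Linear`) consumes.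
Written by the seat `bsd-line-x9-p2` (g3) for the Λ-adic source of STUB 2 of the shared μ-item of crux
stmt-BirchSwinnertonDyer-27077. THEOREMS ONLY; no definition, no named fact, no instance, no `sorry`. BSD is not proved here.

References: [Howard2004HeegnerKolyvagin] B. Howard, Compositio Math. 140 (2004), §2.2, Def. 2.2.3 (`H¹(K, 𝐓)` as a
`Λ`-module), Rem. 1.2.4; [SerreGaloisCohomology1997] I §2.2; [Washington1997] §7.1, §13.1–§13.2; [PerrinRiou1987BSMF] §0 p. 401.
-/

noncomputable section

open scoped TensorProduct Topology ContRepresentation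
open Field CategoryTheory

universe u

namespace Literature.NumberTheory.EllipticCurves

open Literature.NumberTheory.GaloisRepresentations

namespace ZpExtension

variable {K : Type u} [Field K] {p : ℕ} [hp : Fact p.Prime] (κ : ZpExtension K p)
  {M : Type u} [AddCommGroup M] [TopologicalSpace M] [DiscreteTopology M] (ρ : DiscreteGaloisModule K M)
  {A : Type} [CommRing A] {u : A} {J : ℕ} (hu : u ^ (p ^ J) = 1)

/-! ## §1 `H¹(c •)` is the scalar action `scalarMapH1` -/

/-- `M ⊗ A(χ_u)` is an `A`-linear discrete Galois module (`coeffTwist_apply_smul`).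
[cite: Howard2004HeegnerKolyvagin, §2.2 (T_𝔮 is an S_𝔮[Γ_K]-module)] -/
theorem isScalarLinear_coeffTwist : (κ.coeffTwist ρ u J hu).IsScalarLinear A :=
  fun σ c x ↦ κ.coeffTwist_apply_smul ρ hu σ c x

/-- **`H¹(c •) x = scalarMapH1 c x`** (definitional), so `scalarMapH1_add/_mul/_one/_zero/_intCast` apply.
[cite: Howard2004HeegnerKolyvagin, §2.2 and Def. 2.2.3] -/
theorem map_coeffTwistSMulHom_eq_scalarMapH1 (c : A) (x : galoisCohomology (κ.coeffTwist ρ u J hu) 1) :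
    galoisCohomology.map (κ.coeffTwistSMulHom ρ hu c) 1 x =
      galoisCohomology.scalarMapH1 (κ.coeffTwist ρ u J hu) (κ.isScalarLinear_coeffTwist ρ hu) c x :=
  rfl

/-- Additivity: `H¹((a + b) •) x = H¹(a •) x + H¹(b •) x`. [cite: Howard2004HeegnerKolyvagin, §2.2 and Def. 2.2.3] -/
theorem map_coeffTwistSMulHom_add (a b : A) (x : galoisCohomology (κ.coeffTwist ρ u J hu) 1) :
    galoisCohomology.map (κ.coeffTwistSMulHom ρ hu (a + b)) 1 x =
      galoisCohomology.map (κ.coeffTwistSMulHom ρ hu a) 1 x + galoisCohomology.map (κ.coeffTwistSMulHom ρ hu b) 1 x := by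
  rw [map_coeffTwistSMulHom_eq_scalarMapH1, map_coeffTwistSMulHom_eq_scalarMapH1, map_coeffTwistSMulHom_eq_scalarMapH1,
    galoisCohomology.scalarMapH1_add, AddMonoidHom.add_apply]

/-- Multiplicativity: `H¹((a b) •) x = H¹(a •) (H¹(b •) x)`. [cite: Howard2004HeegnerKolyvagin, §2.2 and Def. 2.2.3] -/
theorem map_coeffTwistSMulHom_mul (a b : A) (x : galoisCohomology (κ.coeffTwist ρ u J hu) 1) :
    galoisCohomology.map (κ.coeffTwistSMulHom ρ hu (a * b)) 1 x =
      galoisCohomology.map (κ.coeffTwistSMulHom ρ hu a) 1 (galoisCohomology.map (κ.coeffTwistSMulHom ρ hu b) 1 x) := by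
  rw [map_coeffTwistSMulHom_eq_scalarMapH1, map_coeffTwistSMulHom_eq_scalarMapH1, map_coeffTwistSMulHom_eq_scalarMapH1,
    galoisCohomology.scalarMapH1_mul, AddMonoidHom.comp_apply]

/-- Unit: `H¹(1 •) x = x`. [cite: Howard2004HeegnerKolyvagin, §2.2 and Def. 2.2.3] -/
theorem map_coeffTwistSMulHom_one (x : galoisCohomology (κ.coeffTwist ρ u J hu) 1) :
    galoisCohomology.map (κ.coeffTwistSMulHom ρ hu 1) 1 x = x := by
  rw [map_coeffTwistSMulHom_eq_scalarMapH1, galoisCohomology.scalarMapH1_one, AddMonoidHom.id_apply]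

/-- Zero: `H¹(0 •) x = 0`. [cite: Howard2004HeegnerKolyvagin, §2.2 and Def. 2.2.3] -/
theorem map_coeffTwistSMulHom_zero (x : galoisCohomology (κ.coeffTwist ρ u J hu) 1) :
    galoisCohomology.map (κ.coeffTwistSMulHom ρ hu 0) 1 x = 0 := by
  rw [map_coeffTwistSMulHom_eq_scalarMapH1, galoisCohomology.scalarMapH1_zero, AddMonoidHom.zero_apply]

/-- Integers act as integers: `H¹((z : A) •) x = z • x`. [cite: Howard2004HeegnerKolyvagin, §2.2 and Def. 2.2.3] -/
theorem map_coeffTwistSMulHom_intCast (z : ℤ) (x : galoisCohomology (κ.coeffTwist ρ u J hu) 1) :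
    galoisCohomology.map (κ.coeffTwistSMulHom ρ hu (z : A)) 1 x = z • x := by
  rw [map_coeffTwistSMulHom_eq_scalarMapH1, galoisCohomology.scalarMapH1_intCast]

/-- Equal coefficients give equal maps. [cite: Howard2004HeegnerKolyvagin, §2.2] -/
theorem map_coeffTwistSMulHom_congr {a b : A} (h : a = b) (x : galoisCohomology (κ.coeffTwist ρ u J hu) 1) :
    galoisCohomology.map (κ.coeffTwistSMulHom ρ hu a) 1 x = galoisCohomology.map (κ.coeffTwistSMulHom ρ hu b) 1 x := by
  rw [h]

/-- **Coefficients acting identically on the carrier give the same map on `H¹`** (e.g. `[C c]` and `c mod p^k` on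
`E[p^k] ⊗ A`, whatever `A` is). [cite: SerreGaloisCohomology1997, I §2.2] -/
theorem map_coeffTwistSMulHom_eq_of_forall_smul_eq {a b : A} (h : ∀ y : CoeffExtension ℤ A M, a • y = b • y)
    (x : galoisCohomology (κ.coeffTwist ρ u J hu) 1) :
    galoisCohomology.map (κ.coeffTwistSMulHom ρ hu a) 1 x = galoisCohomology.map (κ.coeffTwistSMulHom ρ hu b) 1 x := by
  have hab : κ.coeffTwistSMulHom ρ hu a = κ.coeffTwistSMulHom ρ hu b :=
    ContIntertwiningMap.ext (ContinuousLinearMap.ext fun y ↦ h y)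
  rw [hab]

/-- The generator `u` minus one: `H¹((u - 1) •) x = H¹(u •) x − x`. [cite: Washington1997, §13.1–§13.2 (T = γ − 1)] -/
theorem map_coeffTwistSMulHom_sub_one (x : galoisCohomology (κ.coeffTwist ρ u J hu) 1) :
    galoisCohomology.map (κ.coeffTwistSMulHom ρ hu (u - 1)) 1 x =
      galoisCohomology.map (κ.coeffTwistSMulHom ρ hu u) 1 x - x := by
  have h := κ.map_coeffTwistSMulHom_add ρ hu (u - 1) 1 x
  rw [sub_add_cancel, map_coeffTwistSMulHom_one] at h
  rw [h, add_sub_cancel_right]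

/-! ## §2 `A = Λ/I`: the generators of `Λ` -/

section Quotient

/-- **`[1 + T]^{p^J} = 1` in `Λ/I` when `ω_J = (1+T)^{p^J} − 1 ∈ I`** (the admissibility hypothesis of `coeffTwist` at
`A = Λ/I`, `u = [1 + T]`). [cite: Washington1997, §13.2 (ω_n = (1+T)^{p^n} − 1, Λ/ω_n = ℤ_p[Γ/Γ_n])] -/
theorem mk_one_add_X_pow_prime_pow_eq_one (I : Ideal (IwasawaAlgebra p))
    (hJ : ((1 + PowerSeries.X : IwasawaAlgebra p) ^ (p ^ J) - 1) ∈ I) :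
    (Ideal.Quotient.mk I (1 + PowerSeries.X : IwasawaAlgebra p)) ^ (p ^ J) = 1 := by
  rw [← map_pow, ← (Ideal.Quotient.mk I).map_one, Ideal.Quotient.eq]
  exact hJ

/-- `[T] = [1 + T] − 1` in `Λ/I`. [cite: Washington1997, §13.1–§13.2] -/
theorem mk_X_eq_mk_one_add_X_sub_one (I : Ideal (IwasawaAlgebra p)) :
    (Ideal.Quotient.mk I (PowerSeries.X : IwasawaAlgebra p)) =
      Ideal.Quotient.mk I (1 + PowerSeries.X : IwasawaAlgebra p) - 1 := by
  rw [map_add, map_one, add_sub_cancel_left]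

variable {I : Ideal (IwasawaAlgebra p)} (hJ : ((1 + PowerSeries.X : IwasawaAlgebra p) ^ (p ^ J) - 1) ∈ I)

/-- **`[T]` acts as `[1+T]• − id`**: `H¹([T] •) x = H¹([1+T] •) x − x` on `H¹(K, M ⊗ (Λ/I)(χ))` — the coefficient side of
`T ↦ conj_γ − 1`. [cite: Howard2004HeegnerKolyvagin, §2.2 (Γ_K acts on Λ through γ ↦ 1 + T)] [cite: Washington1997, §13.1–§13.2] -/
theorem map_coeffTwistSMulHom_mk_X (x : galoisCohomology (κ.coeffTwist ρ (Ideal.Quotient.mk I (1 + PowerSeries.X)) J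
      (mk_one_add_X_pow_prime_pow_eq_one I hJ)) 1) :
    galoisCohomology.map (κ.coeffTwistSMulHom ρ (mk_one_add_X_pow_prime_pow_eq_one I hJ)
        (Ideal.Quotient.mk I PowerSeries.X)) 1 x =
      galoisCohomology.map (κ.coeffTwistSMulHom ρ (mk_one_add_X_pow_prime_pow_eq_one I hJ)
        (Ideal.Quotient.mk I (1 + PowerSeries.X))) 1 x - x := by
  rw [κ.map_coeffTwistSMulHom_congr ρ _ (mk_X_eq_mk_one_add_X_sub_one I) x, map_coeffTwistSMulHom_sub_one]

/-- **A power series in `I` acts by `0`**: `H¹([g] •) x = 0` for `g ∈ I`. [cite: Howard2004HeegnerKolyvagin, §2.2] -/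
theorem map_coeffTwistSMulHom_mk_eq_zero_of_mem {g : IwasawaAlgebra p} (hg : g ∈ I)
    (x : galoisCohomology (κ.coeffTwist ρ (Ideal.Quotient.mk I (1 + PowerSeries.X)) J
      (mk_one_add_X_pow_prime_pow_eq_one I hJ)) 1) :
    galoisCohomology.map (κ.coeffTwistSMulHom ρ (mk_one_add_X_pow_prime_pow_eq_one I hJ) (Ideal.Quotient.mk I g)) 1 x = 0 := by
  rw [κ.map_coeffTwistSMulHom_congr ρ _ (Ideal.Quotient.eq_zero_iff_mem.mpr hg) x, map_coeffTwistSMulHom_zero]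

/-- **A power series with no terms of degree `< N` acts by `0` when `X^N ∈ I`** (`X^N ∣ g`, Mathlib
`PowerSeries.X_pow_dvd_iff`) — the coefficient side of `LambdaAdicSelmerData.proj_cont` for an OPEN ideal `I`.
[cite: Howard2004HeegnerKolyvagin, §2.2] [cite: Washington1997, §7.1] -/
theorem map_coeffTwistSMulHom_mk_eq_zero_of_forall_coeff_eq_zero {N : ℕ} (hN : (PowerSeries.X : IwasawaAlgebra p) ^ N ∈ I)
    (g : IwasawaAlgebra p) (hg : ∀ i < N, PowerSeries.coeff i g = 0)
    (x : galoisCohomology (κ.coeffTwist ρ (Ideal.Quotient.mk I (1 + PowerSeries.X)) J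
      (mk_one_add_X_pow_prime_pow_eq_one I hJ)) 1) :
    galoisCohomology.map (κ.coeffTwistSMulHom ρ (mk_one_add_X_pow_prime_pow_eq_one I hJ) (Ideal.Quotient.mk I g)) 1 x = 0 := by
  obtain ⟨q, hq⟩ := (PowerSeries.X_pow_dvd_iff (n := N) (φ := g)).2 hg
  refine κ.map_coeffTwistSMulHom_mk_eq_zero_of_mem ρ hJ ?_ x
  rw [hq]
  exact Ideal.mul_mem_right _ _ hN

end Quotient

/-! ## §3 Constants on the `p^k`-torsion levels `E[p^k] ⊗ A` -/

section Constants

variable {V : WeierstrassCurve K} (k : ℕ)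

omit hp in
/-- `p^k` kills `E[p^k] ⊗ A` (through the second factor), for ANY coefficient ring `A`.
[cite: Howard2004HeegnerKolyvagin, §2.2 (𝐓/I𝐓 ⊗ ℤ/p^k)] -/
theorem prime_pow_zsmul_coeffExtension_geomTorsion [Fact p.Prime]
    (y : CoeffExtension ℤ A (WeierstrassCurve.geomTorsion V ((p : ℤ) ^ k))) : ((p : ℤ) ^ k) • y = 0 := by
  induction y using CoeffExtension.induction_on with
  | zero => rw [smul_zero]
  | tmul c a =>
    have ha : ((p : ℤ) ^ k) • a = 0 := Subtype.ext (by
      rw [AddSubgroupClass.coe_zsmul, ZeroMemClass.coe_zero]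
      exact (Submodule.mem_torsionBy_iff _ _).1 a.2)
    change ((p : ℤ) ^ k) • (c ⊗ₜ[ℤ] a : A ⊗[ℤ] (WeierstrassCurve.geomTorsion V ((p : ℤ) ^ k))) = 0
    rw [← TensorProduct.tmul_smul, ha, TensorProduct.tmul_zero]
  | add x y hx hy => rw [smul_add, hx, hy, add_zero]

omit hp in
/-- Two coefficients congruent modulo `p^k` act identically on `E[p^k] ⊗ A`.
[cite: Howard2004HeegnerKolyvagin, §2.2] -/
theorem smul_eq_smul_of_sub_eq_natCast_pow_mul [Fact p.Prime] {a b : A} {d : A} (h : a - b = (p : A) ^ k * d)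
    (y : CoeffExtension ℤ A (WeierstrassCurve.geomTorsion V ((p : ℤ) ^ k))) : a • y = b • y := by
  rw [← sub_eq_zero, ← sub_smul, h, mul_comm, mul_smul]
  have : ((p : A) ^ k) • y = ((p : ℤ) ^ k) • y := by
    rw [← Int.cast_smul_eq_zsmul A, Int.cast_pow, Int.cast_natCast]
  rw [this, prime_pow_zsmul_coeffExtension_geomTorsion k y, smul_zero]

variable {I : Ideal (IwasawaAlgebra p)} (hJ : ((1 + PowerSeries.X : IwasawaAlgebra p) ^ (p ^ J) - 1) ∈ I)
  (τ : DiscreteGaloisModule K (WeierstrassCurve.geomTorsion V ((p : ℤ) ^ k)))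

/-- **`[C c]` acts on `H¹(K, E[p^k] ⊗ (Λ/I)(χ))` as the integer `c mod p^k`**: `H¹([C c] •) x = ((c mod p^k) : ℤ) • x`
(spelled with `(PadicInt.toZModPow k c).val` as in `LambdaAdicSelmerData.proj_C`), for ANY ideal `I` — `[C c]` and
`c mod p^k` differ by `p^k · [C d]` (`PadicInt.appr_spec`), which kills `E[p^k] ⊗ (Λ/I)`.
[cite: Howard2004HeegnerKolyvagin, §2.2 and Def. 2.2.3] [cite: PerrinRiou1987BSMF, §0 p. 401] -/
theorem map_coeffTwistSMulHom_mk_C (c : ℤ_[p])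
    (x : galoisCohomology (κ.coeffTwist τ (Ideal.Quotient.mk I (1 + PowerSeries.X)) J
      (mk_one_add_X_pow_prime_pow_eq_one I hJ)) 1) :
    galoisCohomology.map (κ.coeffTwistSMulHom τ (mk_one_add_X_pow_prime_pow_eq_one I hJ)
        (Ideal.Quotient.mk I (PowerSeries.C c))) 1 x = ((PadicInt.toZModPow k c).val : ℤ) • x := by
  -- `C c − (appr c k) = p^k · C d` in `Λ`
  obtain ⟨d, hd⟩ := Ideal.mem_span_singleton.mp (PadicInt.appr_spec k c)
  have hd' : (PowerSeries.C c : IwasawaAlgebra p) - ((c.appr k : ℕ) : IwasawaAlgebra p) =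
      (p : IwasawaAlgebra p) ^ k * PowerSeries.C d := by
    rw [← map_natCast (PowerSeries.C (R := ℤ_[p])) (c.appr k), ← map_sub, hd, map_mul, map_pow, map_natCast]
  have hsub : (Ideal.Quotient.mk I (PowerSeries.C c)) - ((c.appr k : ℕ) : IwasawaAlgebra p ⧸ I) =
      (p : IwasawaAlgebra p ⧸ I) ^ k * Ideal.Quotient.mk I (PowerSeries.C d) := by
    have h := congrArg (Ideal.Quotient.mk I) hd'
    simpa only [map_sub, map_natCast, map_mul, map_pow] using h
  rw [κ.map_coeffTwistSMulHom_eq_of_forall_smul_eq τ _ (smul_eq_smul_of_sub_eq_natCast_pow_mul k hsub) x,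
    ZpExtension.val_toZModPow_eq_appr,
    κ.map_coeffTwistSMulHom_congr τ _ (show ((c.appr k : ℕ) : IwasawaAlgebra p ⧸ I) = ((c.appr k : ℤ) : _) by
      rw [Int.cast_natCast]) x,
    map_coeffTwistSMulHom_intCast]

end Constants

/-! ## §4 The inverse extension: `γ` acts as `u •` after `coresCoeff` -/

/-- For a topological generator `γ` of `κ`, at the INVERSE extension `κ⁻ = κ.unitTwist (-1)` (`κ̄⁻_J(γ) = −1`):
`coresCoeff (γ · c) = H¹(u •) (coresCoeff c)` — the control map built on `κ⁻` intertwines `conj_γ` with `u •`, i.e.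
`T = conj_γ − 1` with `[T] = u − 1`: it is `Λ`-LINEAR. [cite: Washington1997, §13.1–§13.2]
[cite: Howard2004HeegnerKolyvagin, §2.2 (𝔖 → H¹(K, T_𝔮) is a map of Λ-modules)] -/
theorem coresCoeff_unitTwist_conjMap_of_isTopGenerator {γ : absoluteGaloisGroup K} (hγ : κ.IsTopGenerator γ)
    (N : Subgroup (absoluteGaloisGroup K)) [N.Normal] (hN : N ≤ (κ.unitTwist (-1)).layerSubgroup J)
    (hNo : IsOpen (N : Set (absoluteGaloisGroup K))) [Fintype (absoluteGaloisGroup K ⧸ N)]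
    (c : continuousCohomology 1 (subgroupRep ρ.toTopRep N)) :
    (κ.unitTwist (-1)).coresCoeff ρ hu N hN hNo (conjMap ρ.toTopRep N γ 1 c) =
      galoisCohomology.map ((κ.unitTwist (-1)).coeffTwistSMulHom ρ hu u) 1
        ((κ.unitTwist (-1)).coresCoeff ρ hu N hN hNo c) :=
  (κ.unitTwist (-1)).coresCoeff_conjMap_of_layerIndex_eq_neg_one ρ hu N hN hNo
    (κ.layerIndex_unitTwist_neg_one_of_isTopGenerator hγ J) c

end ZpExtension

end Literature.NumberTheory.EllipticCurves

end
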